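import Mathlib
import HarnessLib
import Summits.HubbardSuperconductivity.HubbardSuperconductivity.Theorems.BalabanIRBirComplexStableXYFixedVolumeLaplace

/-!
# BalabanIR engine `BirComplexStableXY` (stmt-HubbardSuperconductivity-2080): the multidimensional
Laplace method with a complex phase — an explicit `O(1/√K)` rate

Support lemmas for crux 2 of route BalabanIR (`--supports stmt-HubbardSuperconductivity-2080`),
quantitative companion of `BalabanIRBirComplexStableXYFixedVolumeLaplace.lean` (abstract part, no
definitions).  Under the hypotheses of `birLaplace_tendsto` plus a Lipschitz-at-`0` bound for the
amplitude (`‖g δ − g 0‖ ≤ L_g ‖δ‖` on `S`) and a ball `B(0, ρ) ⊆ S`, for every `K ≥ 1`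

  `‖(√K)^{|ι|} ∫_S g e^{−K f} − g 0 ∫ e^{−q}‖ ≤ A₀ / √K`        (`birLaplace_rate`)

with `A₀ = (L_g B₁ + G₀ C B₂ + 2 G₀ /(m ρ²)) ∫ e^{−(m/2) Σ u_i²}`, `B₁ = (1 + 2/m)/2`,
`B₂ = (2/m)(1 + 4/m)`, depending on the data ONLY through the constants `m, C, G₀, L_g, ρ` and the
index type — this is what makes the fixed-volume stability uniform over the admissible class of
Fourier tables (companion files).  Ingredients: the pointwise bound
`‖e^{−a} − e^{−b}‖ ≤ ‖a − b‖ e^{−μ}` for `Re a, Re b ≥ μ` (mean value inequality on the segment,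
`birRate_norm_cexp_sub_cexp_le`), elementary Gaussian-moment bounds `t² e^{−ct²} ≤ 1/c`,
and `birLaplace_scaling` / `birLaplace_domination` / `birLaplace_re_quad_ge` of the companion file.
-/

namespace Summit.HubbardSuperconductivity.HubbardSuperconductivity.Theorems

open scoped BigOperators
open MeasureTheory Filter Topology Set

section Rate

variable {ι : Type*} [Fintype ι]

/-- Mean value bound for the exponential on a half-plane:
`‖e^{−a} − e^{−b}‖ ≤ ‖a − b‖ e^{−μ}` if `μ ≤ Re a` and `μ ≤ Re b`. -/
theorem birRate_norm_cexp_sub_cexp_le {a b : ℂ} {μ : ℝ} (ha : μ ≤ a.re) (hb : μ ≤ b.re) :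
    ‖Complex.exp (-a) - Complex.exp (-b)‖ ≤ ‖a - b‖ * Real.exp (-μ) := by
  -- the segment `t ↦ exp (-(b + t (a - b)))`
  set φ : ℝ → ℂ := fun t => Complex.exp (-(b + (t : ℂ) * (a - b))) with hφ
  have hderiv : ∀ t : ℝ, HasDerivAt φ (Complex.exp (-(b + (t : ℂ) * (a - b))) * (-(a - b))) t := by
    intro t
    have h1 : HasDerivAt (fun t : ℝ => -(b + (t : ℂ) * (a - b))) (-(1 * (a - b))) t := by
      have := ((hasDerivAt_id t).ofReal_comp.mul_const (a - b)).const_add b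
      exact this.neg
    exact (h1.cexp).congr_deriv (by ring)
  have hbound : ∀ t ∈ Ico (0 : ℝ) 1,
      ‖Complex.exp (-(b + (t : ℂ) * (a - b))) * (-(a - b))‖ ≤ ‖a - b‖ * Real.exp (-μ) := by
    intro t ht
    rw [norm_mul, norm_neg, Complex.norm_exp, mul_comm]
    refine mul_le_mul_of_nonneg_left ?_ (norm_nonneg _)
    rw [Real.exp_le_exp]
    have hre : (-(b + (t : ℂ) * (a - b))).re = -((1 - t) * b.re + t * a.re) := by
      simp only [Complex.neg_re, Complex.add_re, Complex.mul_re, Complex.ofReal_re,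
        Complex.ofReal_im, Complex.sub_re, Complex.sub_im, zero_mul, sub_zero]
      ring
    rw [hre]
    have ht0 : 0 ≤ t := ht.1
    have ht1 : 0 ≤ 1 - t := by linarith [ht.2]
    nlinarith [mul_le_mul_of_nonneg_left hb ht1, mul_le_mul_of_nonneg_left ha ht0]
  have h := norm_image_sub_le_of_norm_deriv_le_segment_01' (f := φ)
    (fun t _ => (hderiv t).hasDerivWithinAt) hbound
  have hφ1 : φ 1 = Complex.exp (-a) := by
    simp only [hφ, Complex.ofReal_one, one_mul]; congr 1; ring
  have hφ0 : φ 0 = Complex.exp (-b) := by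
    simp only [hφ, Complex.ofReal_zero, zero_mul, add_zero]
  rw [hφ1, hφ0] at h
  exact h

/-- Gaussian moment bound: `x e^{−c x} ≤ 1/c` for `c > 0` and every real `x`. -/
theorem birRate_mul_exp_neg_le {c : ℝ} (hc : 0 < c) (x : ℝ) :
    x * Real.exp (-(c * x)) ≤ 1 / c := by
  have h1 : c * x ≤ Real.exp (c * x) := by linarith [Real.add_one_le_exp (c * x)]
  have h2 : 0 ≤ Real.exp (-(c * x)) := (Real.exp_pos _).le
  have h3 : c * x * Real.exp (-(c * x)) ≤ 1 := by
    calc c * x * Real.exp (-(c * x)) ≤ Real.exp (c * x) * Real.exp (-(c * x)) :=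
          mul_le_mul_of_nonneg_right h1 h2
      _ = 1 := by rw [← Real.exp_add, add_neg_cancel, Real.exp_zero]
  rw [le_div_iff₀ hc]
  linarith

/-- Gaussian moment bound: `t e^{−c t²} ≤ (1 + 1/c)/2` for `c > 0`, `t` real. -/
theorem birRate_mul_exp_neg_sq_le {c : ℝ} (hc : 0 < c) (t : ℝ) :
    t * Real.exp (-(c * t ^ 2)) ≤ (1 + 1 / c) / 2 := by
  have h0 : 0 ≤ Real.exp (-(c * t ^ 2)) := (Real.exp_pos _).le
  have h1 : Real.exp (-(c * t ^ 2)) ≤ 1 := by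
    rw [Real.exp_le_one_iff]; nlinarith [sq_nonneg t]
  have h2 : t ^ 2 * Real.exp (-(c * t ^ 2)) ≤ 1 / c := birRate_mul_exp_neg_le hc (t ^ 2)
  have h3 : t ≤ (1 + t ^ 2) / 2 := by nlinarith [sq_nonneg (t - 1)]
  calc t * Real.exp (-(c * t ^ 2)) ≤ (1 + t ^ 2) / 2 * Real.exp (-(c * t ^ 2)) :=
        mul_le_mul_of_nonneg_right h3 h0
    _ = (Real.exp (-(c * t ^ 2)) + t ^ 2 * Real.exp (-(c * t ^ 2))) / 2 := by ring
    _ ≤ (1 + 1 / c) / 2 := by linarith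

/-- The Gaussian moment factor of the Lipschitz term:
`‖u‖ e^{−m s} ≤ (1 + 2/m)/2 · e^{−(m/2) s}` for `s = Σ u_i²`. -/
theorem birRate_moment_one {m : ℝ} (hm : 0 < m) (u : ι → ℝ) :
    ‖u‖ * Real.exp (-m * ∑ i, u i ^ 2)
      ≤ (1 + 2 / m) / 2 * Real.exp (-(m / 2) * ∑ i, u i ^ 2) := by
  set s : ℝ := ∑ i, u i ^ 2 with hs
  have hns : ‖u‖ ^ 2 ≤ s := birLaplace_norm_sq_le_sum_sq u
  have hE : 0 ≤ Real.exp (-(m / 2) * s) := (Real.exp_pos _).le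
  have h1 : Real.exp (-m * s) ≤ Real.exp (-(m / 2 * ‖u‖ ^ 2)) * Real.exp (-(m / 2) * s) := by
    rw [← Real.exp_add, Real.exp_le_exp]; nlinarith
  have h2 : ‖u‖ * Real.exp (-(m / 2 * ‖u‖ ^ 2)) ≤ (1 + 1 / (m / 2)) / 2 :=
    birRate_mul_exp_neg_sq_le (by positivity) ‖u‖
  have h3 : (1 + 1 / (m / 2)) / 2 = (1 + 2 / m) / 2 := by field_simp
  calc ‖u‖ * Real.exp (-m * s) ≤ ‖u‖ * (Real.exp (-(m / 2 * ‖u‖ ^ 2)) * Real.exp (-(m / 2) * s)) :=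
        mul_le_mul_of_nonneg_left h1 (norm_nonneg _)
    _ = (‖u‖ * Real.exp (-(m / 2 * ‖u‖ ^ 2))) * Real.exp (-(m / 2) * s) := by ring
    _ ≤ (1 + 2 / m) / 2 * Real.exp (-(m / 2) * s) := by
        rw [← h3]; exact mul_le_mul_of_nonneg_right h2 hE

/-- The Gaussian moment factor of the phase-comparison term:
`s ‖u‖ e^{−m s} ≤ (2/m)(1 + 4/m) · e^{−(m/2) s}` for `s = Σ u_i²`. -/
theorem birRate_moment_three {m : ℝ} (hm : 0 < m) (u : ι → ℝ) :
    (∑ i, u i ^ 2) * ‖u‖ * Real.exp (-m * ∑ i, u i ^ 2)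
      ≤ (2 / m) * (1 + 4 / m) * Real.exp (-(m / 2) * ∑ i, u i ^ 2) := by
  set s : ℝ := ∑ i, u i ^ 2 with hs
  have hs0 : 0 ≤ s := Finset.sum_nonneg fun i _ => sq_nonneg _
  have hns : ‖u‖ ^ 2 ≤ s := birLaplace_norm_sq_le_sum_sq u
  have hE : 0 ≤ Real.exp (-(m / 2) * s) := (Real.exp_pos _).le
  have h1 : Real.exp (-m * s)
      ≤ Real.exp (-(m / 4 * s)) * Real.exp (-(m / 4 * ‖u‖ ^ 2)) * Real.exp (-(m / 2) * s) := by
    rw [← Real.exp_add, ← Real.exp_add, Real.exp_le_exp]; nlinarith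
  have h2 : s * Real.exp (-(m / 4 * s)) ≤ 1 / (m / 4) := birRate_mul_exp_neg_le (by positivity) s
  have h3 : ‖u‖ * Real.exp (-(m / 4 * ‖u‖ ^ 2)) ≤ (1 + 1 / (m / 4)) / 2 :=
    birRate_mul_exp_neg_sq_le (by positivity) ‖u‖
  have h4 : (1 / (m / 4)) * ((1 + 1 / (m / 4)) / 2) = (2 / m) * (1 + 4 / m) := by
    field_simp; ring
  have hB : 0 ≤ ‖u‖ * Real.exp (-(m / 4 * ‖u‖ ^ 2)) := mul_nonneg (norm_nonneg _) (Real.exp_pos _).le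
  calc s * ‖u‖ * Real.exp (-m * s)
      ≤ s * ‖u‖ * (Real.exp (-(m / 4 * s)) * Real.exp (-(m / 4 * ‖u‖ ^ 2)) * Real.exp (-(m / 2) * s)) :=
        mul_le_mul_of_nonneg_left h1 (mul_nonneg hs0 (norm_nonneg _))
    _ = (s * Real.exp (-(m / 4 * s))) * (‖u‖ * Real.exp (-(m / 4 * ‖u‖ ^ 2)))
          * Real.exp (-(m / 2) * s) := by ring
    _ ≤ (1 / (m / 4)) * ((1 + 1 / (m / 4)) / 2) * Real.exp (-(m / 2) * s) := by
        refine mul_le_mul_of_nonneg_right ?_ hE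
        exact mul_le_mul h2 h3 hB (by positivity)
    _ = (2 / m) * (1 + 4 / m) * Real.exp (-(m / 2) * s) := by rw [h4]

/-- Pointwise rate, inside the domain: with `K R² = 1` and `R u ∈ S`,
`‖g(Ru) e^{−K f(Ru)} − g(0) e^{−q u}‖ ≤ (L_g B₁ + G₀ C B₂) R e^{−(m/2)Σu²}`. -/
theorem birRate_pointwise_inside {S : Set (ι → ℝ)} {f q g : (ι → ℝ) → ℂ}
    (hqhom : ∀ (t : ℝ) (u : ι → ℝ), q (t • u) = (t : ℂ) ^ 2 * q u)
    {m C G₀ Lg K R : ℝ} (hm : 0 < m) (hC : 0 ≤ C) (hG₀ : 0 ≤ G₀) (hLg : 0 ≤ Lg)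
    (hK0 : 0 < K) (hR0 : 0 < R) (hKR : K * R ^ 2 = 1)
    (hre : ∀ δ ∈ S, m * ∑ i, δ i ^ 2 ≤ (f δ).re)
    (hrem : ∀ δ ∈ S, ‖f δ - q δ‖ ≤ C * (∑ i, δ i ^ 2) * ‖δ‖)
    (hg0 : ‖g 0‖ ≤ G₀) (hgL : ∀ δ ∈ S, ‖g δ - g 0‖ ≤ Lg * ‖δ‖)
    (hre_q : ∀ u : ι → ℝ, m * ∑ i, u i ^ 2 ≤ (q u).re)
    (u : ι → ℝ) (hmem : R • u ∈ S) :
    ‖g (R • u) * Complex.exp (-((K : ℂ) * f (R • u))) - g 0 * Complex.exp (-q u)‖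
      ≤ (Lg * ((1 + 2 / m) / 2) + G₀ * C * ((2 / m) * (1 + 4 / m))) * R
          * Real.exp (-(m / 2) * ∑ i, u i ^ 2) := by
  set s : ℝ := ∑ i, u i ^ 2 with hs
  have hs0 : 0 ≤ s := Finset.sum_nonneg fun i _ => sq_nonneg _
  have hE : 0 ≤ Real.exp (-(m / 2) * s) := (Real.exp_pos _).le
  have hnRu : ‖R • u‖ = R * ‖u‖ := by rw [norm_smul, Real.norm_eq_abs, abs_of_pos hR0]
  have hsRu : ∑ i, (R • u) i ^ 2 = R ^ 2 * s := birLaplace_sum_sq_smul R u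
  -- real parts
  have hre1 : m * s ≤ ((K : ℂ) * f (R • u)).re := by
    rw [Complex.re_ofReal_mul]
    have h := hre _ hmem
    rw [hsRu] at h
    have h' : K * (m * (R ^ 2 * s)) ≤ K * (f (R • u)).re := mul_le_mul_of_nonneg_left h hK0.le
    calc m * s = K * (m * (R ^ 2 * s)) := by
          rw [show K * (m * (R ^ 2 * s)) = m * s * (K * R ^ 2) by ring, hKR, mul_one]
      _ ≤ K * (f (R • u)).re := h'
  have hre2 : m * s ≤ (q u).re := hre_q u
  have hexp1 : ‖Complex.exp (-((K : ℂ) * f (R • u)))‖ ≤ Real.exp (-m * s) := by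
    rw [Complex.norm_exp, Complex.neg_re, Real.exp_le_exp]; linarith
  -- the phase difference
  have hdiff : ‖(K : ℂ) * f (R • u) - q u‖ ≤ C * s * ‖u‖ * R := by
    have hq' : (K : ℂ) * q (R • u) = q u := by
      rw [hqhom, ← mul_assoc]
      have h1 : (K : ℂ) * (R : ℂ) ^ 2 = ((K * R ^ 2 : ℝ) : ℂ) := by push_cast; ring
      rw [h1, hKR]; simp
    have h2 : (K : ℂ) * f (R • u) - q u = (K : ℂ) * (f (R • u) - q (R • u)) := by
      rw [mul_sub, hq']
    rw [h2, norm_mul, Complex.norm_real, Real.norm_eq_abs, abs_of_pos hK0]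
    have h3 := hrem _ hmem
    rw [hsRu, hnRu] at h3
    calc K * ‖f (R • u) - q (R • u)‖ ≤ K * (C * (R ^ 2 * s) * (R * ‖u‖)) :=
          mul_le_mul_of_nonneg_left h3 hK0.le
      _ = C * s * ‖u‖ * R * (K * R ^ 2) := by ring
      _ = C * s * ‖u‖ * R := by rw [hKR, mul_one]
  have hmom1 := birRate_moment_one hm u
  have hmom2 := birRate_moment_three hm u
  have hT1 : ‖(g (R • u) - g 0) * Complex.exp (-((K : ℂ) * f (R • u)))‖
      ≤ Lg * ((1 + 2 / m) / 2) * R * Real.exp (-(m / 2) * s) := by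
    rw [norm_mul]
    have h1 : ‖g (R • u) - g 0‖ ≤ Lg * (R * ‖u‖) := by rw [← hnRu]; exact hgL _ hmem
    have h1' : 0 ≤ Lg * (R * ‖u‖) := by positivity
    calc ‖g (R • u) - g 0‖ * ‖Complex.exp (-((K : ℂ) * f (R • u)))‖
        ≤ Lg * (R * ‖u‖) * Real.exp (-m * s) := mul_le_mul h1 hexp1 (norm_nonneg _) h1'
      _ = Lg * R * (‖u‖ * Real.exp (-m * s)) := by ring
      _ ≤ Lg * R * ((1 + 2 / m) / 2 * Real.exp (-(m / 2) * s)) :=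
          mul_le_mul_of_nonneg_left hmom1 (by positivity)
      _ = Lg * ((1 + 2 / m) / 2) * R * Real.exp (-(m / 2) * s) := by ring
  have hT2 : ‖g 0 * (Complex.exp (-((K : ℂ) * f (R • u))) - Complex.exp (-q u))‖
      ≤ G₀ * C * ((2 / m) * (1 + 4 / m)) * R * Real.exp (-(m / 2) * s) := by
    rw [norm_mul]
    have h2 := birRate_norm_cexp_sub_cexp_le hre1 hre2
    calc ‖g 0‖ * ‖Complex.exp (-((K : ℂ) * f (R • u))) - Complex.exp (-q u)‖
        ≤ G₀ * (‖(K : ℂ) * f (R • u) - q u‖ * Real.exp (-(m * s))) :=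
          mul_le_mul hg0 h2 (norm_nonneg _) hG₀
      _ ≤ G₀ * (C * s * ‖u‖ * R * Real.exp (-(m * s))) := by
          refine mul_le_mul_of_nonneg_left ?_ hG₀
          exact mul_le_mul_of_nonneg_right hdiff (Real.exp_pos _).le
      _ = G₀ * C * R * (s * ‖u‖ * Real.exp (-m * s)) := by ring_nf
      _ ≤ G₀ * C * R * ((2 / m) * (1 + 4 / m) * Real.exp (-(m / 2) * s)) :=
          mul_le_mul_of_nonneg_left hmom2 (by positivity)
      _ = G₀ * C * ((2 / m) * (1 + 4 / m)) * R * Real.exp (-(m / 2) * s) := by ring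
  have hsplit : g (R • u) * Complex.exp (-((K : ℂ) * f (R • u))) - g 0 * Complex.exp (-q u)
      = (g (R • u) - g 0) * Complex.exp (-((K : ℂ) * f (R • u)))
        + g 0 * (Complex.exp (-((K : ℂ) * f (R • u))) - Complex.exp (-q u)) := by ring
  rw [hsplit]
  calc ‖(g (R • u) - g 0) * Complex.exp (-((K : ℂ) * f (R • u)))
        + g 0 * (Complex.exp (-((K : ℂ) * f (R • u))) - Complex.exp (-q u))‖
      ≤ Lg * ((1 + 2 / m) / 2) * R * Real.exp (-(m / 2) * s)
        + G₀ * C * ((2 / m) * (1 + 4 / m)) * R * Real.exp (-(m / 2) * s) :=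
        (norm_add_le _ _).trans (add_le_add hT1 hT2)
    _ = (Lg * ((1 + 2 / m) / 2) + G₀ * C * ((2 / m) * (1 + 4 / m))) * R
          * Real.exp (-(m / 2) * s) := by ring

/-- Pointwise rate, outside the domain (`R u ∉ S ⊇ B(0,ρ)`, `R = 1/√K`, `K ≥ 1`): the limit
term alone is in the Gaussian tail, `‖g(0) e^{−q u}‖ ≤ (2 G₀/(m ρ²)) /√K · e^{−(m/2)Σu²}`. -/
theorem birRate_pointwise_outside {S : Set (ι → ℝ)} {ρ : ℝ} (hρ : 0 < ρ)
    (hball : Metric.ball (0 : ι → ℝ) ρ ⊆ S) {q g : (ι → ℝ) → ℂ}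
    {m G₀ K : ℝ} (hm : 0 < m) (hG₀ : 0 ≤ G₀) (hK : 1 ≤ K)
    (hg0 : ‖g 0‖ ≤ G₀) (hre_q : ∀ u : ι → ℝ, m * ∑ i, u i ^ 2 ≤ (q u).re)
    (u : ι → ℝ) (hmem : (Real.sqrt K)⁻¹ • u ∉ S) :
    ‖g 0 * Complex.exp (-q u)‖
      ≤ (2 * G₀ / (m * ρ ^ 2)) / Real.sqrt K * Real.exp (-(m / 2) * ∑ i, u i ^ 2) := by
  set s : ℝ := ∑ i, u i ^ 2 with hs
  have hK0 : 0 < K := by linarith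
  have hsK : 0 < Real.sqrt K := Real.sqrt_pos.2 hK0
  have hsK1 : 1 ≤ Real.sqrt K := by rw [← Real.sqrt_one]; exact Real.sqrt_le_sqrt hK
  have hns : ‖u‖ ^ 2 ≤ s := birLaplace_norm_sq_le_sum_sq u
  have hE : 0 ≤ Real.exp (-(m / 2) * s) := (Real.exp_pos _).le
  have hfar : ρ * Real.sqrt K ≤ ‖u‖ := by
    have h1 : (Real.sqrt K)⁻¹ • u ∉ Metric.ball (0 : ι → ℝ) ρ := fun h => hmem (hball h)
    rw [Metric.mem_ball, dist_zero_right, not_lt, norm_smul, norm_inv, Real.norm_eq_abs,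
      abs_of_pos hsK, inv_mul_eq_div, le_div_iff₀ hsK] at h1
    exact h1
  have hsK2 : ρ ^ 2 * K ≤ s := by
    have h1 : (ρ * Real.sqrt K) ^ 2 ≤ ‖u‖ ^ 2 := pow_le_pow_left₀ (by positivity) hfar 2
    rw [mul_pow, Real.sq_sqrt hK0.le] at h1
    linarith
  have htail : Real.exp (-m * s) ≤ 2 / (m * ρ ^ 2) / Real.sqrt K * Real.exp (-(m / 2) * s) := by
    have h1 : Real.exp (-m * s) = Real.exp (-(m / 2 * s)) * Real.exp (-(m / 2) * s) := by
      rw [← Real.exp_add]; ring_nf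
    have h2 : Real.exp (-(m / 2 * s)) ≤ Real.exp (-(m / 2 * (ρ ^ 2 * K))) := by
      rw [Real.exp_le_exp]; nlinarith
    have hy : 0 < m / 2 * (ρ ^ 2 * K) := by positivity
    have h3 : Real.exp (-(m / 2 * (ρ ^ 2 * K))) ≤ 1 / (m / 2 * (ρ ^ 2 * K)) := by
      have := birRate_mul_exp_neg_le hy 1
      rw [mul_one, one_mul] at this
      exact this
    have h4 : 1 / (m / 2 * (ρ ^ 2 * K)) ≤ 2 / (m * ρ ^ 2) / Real.sqrt K := by
      rw [div_div, div_le_div_iff₀ hy (by positivity)]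
      have hKK : Real.sqrt K ≤ K := by
        calc Real.sqrt K = Real.sqrt K * 1 := (mul_one _).symm
          _ ≤ Real.sqrt K * Real.sqrt K := mul_le_mul_of_nonneg_left hsK1 hsK.le
          _ = K := Real.mul_self_sqrt hK0.le
      have : 0 ≤ m * ρ ^ 2 := by positivity
      nlinarith
    rw [h1]
    exact mul_le_mul_of_nonneg_right ((h2.trans h3).trans h4) hE
  rw [norm_mul, Complex.norm_exp, Complex.neg_re]
  have h2 : Real.exp (-(q u).re) ≤ Real.exp (-m * s) := by
    rw [Real.exp_le_exp]; linarith [hre_q u]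
  calc ‖g 0‖ * Real.exp (-(q u).re) ≤ G₀ * Real.exp (-m * s) :=
        mul_le_mul hg0 h2 (Real.exp_pos _).le hG₀
    _ ≤ G₀ * (2 / (m * ρ ^ 2) / Real.sqrt K * Real.exp (-(m / 2) * s)) :=
        mul_le_mul_of_nonneg_left htail hG₀
    _ = (2 * G₀ / (m * ρ ^ 2)) / Real.sqrt K * Real.exp (-(m / 2) * s) := by ring

/-- **Laplace method with an explicit rate.**  Under the hypotheses of `birLaplace_tendsto`
plus `B(0,ρ) ⊆ S`, `‖g δ − g 0‖ ≤ L_g ‖δ‖` on `S` (`C, L_g ≥ 0`), for every `K ≥ 1`: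
`‖(√K)^{|ι|} ∫_S g e^{−Kf} − g 0 ∫ e^{−q}‖ ≤ A₁ (∫ e^{−(m/2)Σu²}) / √K` with
`A₁ = L_g (1 + 2/m)/2 + G₀ C (2/m)(1 + 4/m) + 2 G₀ /(m ρ²)`. -/
theorem birLaplace_rate {S : Set (ι → ℝ)} (hS : MeasurableSet S) {ρ : ℝ} (hρ : 0 < ρ)
    (hball : Metric.ball (0 : ι → ℝ) ρ ⊆ S)
    {f q : (ι → ℝ) → ℂ} (hf : Continuous f) (hq : Continuous q)
    (hqhom : ∀ (t : ℝ) (u : ι → ℝ), q (t • u) = (t : ℂ) ^ 2 * q u)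
    {m C : ℝ} (hm : 0 < m) (hC : 0 ≤ C) (hre : ∀ δ ∈ S, m * ∑ i, δ i ^ 2 ≤ (f δ).re)
    (hrem : ∀ δ ∈ S, ‖f δ - q δ‖ ≤ C * (∑ i, δ i ^ 2) * ‖δ‖)
    {g : (ι → ℝ) → ℂ} (hg : Continuous g) {G₀ Lg : ℝ} (hLg : 0 ≤ Lg)
    (hgb : ∀ δ ∈ S, ‖g δ‖ ≤ G₀) (hgL : ∀ δ ∈ S, ‖g δ - g 0‖ ≤ Lg * ‖δ‖)
    {K : ℝ} (hK : 1 ≤ K) :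
    ‖(((Real.sqrt K) ^ Fintype.card ι : ℝ) : ℂ) * (∫ δ in S, g δ * Complex.exp (-((K : ℂ) * f δ)))
        - g 0 * ∫ u : ι → ℝ, Complex.exp (-q u)‖
      ≤ (Lg * ((1 + 2 / m) / 2) + G₀ * C * ((2 / m) * (1 + 4 / m)) + 2 * G₀ / (m * ρ ^ 2))
          * (∫ u : ι → ℝ, Real.exp (-(m / 2) * ∑ i, u i ^ 2)) / Real.sqrt K := by
  have hS0 : S ∈ 𝓝 (0 : ι → ℝ) := mem_of_superset (Metric.ball_mem_nhds 0 hρ) hball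
  have hG₀ : 0 ≤ G₀ := birLaplace_bound_nonneg hS0 hgb
  have hg0 : ‖g 0‖ ≤ G₀ := hgb 0 (mem_of_mem_nhds hS0)
  have hK0 : 0 < K := by linarith
  have hsK : 0 < Real.sqrt K := Real.sqrt_pos.2 hK0
  have hR0 : 0 < (Real.sqrt K)⁻¹ := inv_pos.2 hsK
  have hKR : K * (Real.sqrt K)⁻¹ ^ 2 = 1 := by
    rw [inv_pow, Real.sq_sqrt hK0.le]; field_simp
  have hre_q : ∀ u : ι → ℝ, m * ∑ i, u i ^ 2 ≤ (q u).re :=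
    birLaplace_re_quad_ge hS0 hqhom hre hrem
  -- the two integrands
  have hΦK_meas : AEStronglyMeasurable (fun u : ι → ℝ =>
      S.indicator (fun δ => g δ * Complex.exp (-((K : ℂ) * f δ))) ((Real.sqrt K)⁻¹ • u)) volume := by
    have hmeas : MeasurableSet ((fun u : ι → ℝ => (Real.sqrt K)⁻¹ • u) ⁻¹' S) :=
      (continuous_const_smul _).measurable hS
    have : (fun u : ι → ℝ => S.indicator (fun δ => g δ * Complex.exp (-((K : ℂ) * f δ)))
        ((Real.sqrt K)⁻¹ • u)) = ((fun u : ι → ℝ => (Real.sqrt K)⁻¹ • u) ⁻¹' S).indicator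
          (fun u => g ((Real.sqrt K)⁻¹ • u) *
            Complex.exp (-((K : ℂ) * f ((Real.sqrt K)⁻¹ • u)))) := by
      ext u; simp only [Set.indicator, Set.mem_preimage]; rfl
    rw [this]
    exact (Continuous.aestronglyMeasurable (by fun_prop)).indicator hmeas
  have hΦK_int : Integrable (fun u : ι → ℝ =>
      S.indicator (fun δ => g δ * Complex.exp (-((K : ℂ) * f δ))) ((Real.sqrt K)⁻¹ • u)) := by
    refine Integrable.mono' (birLaplace_integrable_gaussian hm G₀) hΦK_meas
      (Eventually.of_forall fun u => ?_)
    exact birLaplace_domination hre hG₀ hgb hK0 u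
  have hΦ_int : Integrable (fun u : ι → ℝ => g 0 * Complex.exp (-q u)) :=
    (birLaplace_integrable_cexp_neg_quad hS0 hq hqhom hm hre hrem).const_mul _
  -- the pointwise bound
  set A₁ : ℝ := Lg * ((1 + 2 / m) / 2) + G₀ * C * ((2 / m) * (1 + 4 / m)) + 2 * G₀ / (m * ρ ^ 2)
    with hA₁
  have hT12 : 0 ≤ Lg * ((1 + 2 / m) / 2) + G₀ * C * ((2 / m) * (1 + 4 / m)) := by positivity
  have hT3 : 0 ≤ 2 * G₀ / (m * ρ ^ 2) := by positivity
  have hpt : ∀ u : ι → ℝ,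
      ‖S.indicator (fun δ => g δ * Complex.exp (-((K : ℂ) * f δ))) ((Real.sqrt K)⁻¹ • u)
        - g 0 * Complex.exp (-q u)‖
        ≤ A₁ / Real.sqrt K * Real.exp (-(m / 2) * ∑ i, u i ^ 2) := by
    intro u
    have hE : 0 ≤ Real.exp (-(m / 2) * ∑ i, u i ^ 2) := (Real.exp_pos _).le
    by_cases hmem : (Real.sqrt K)⁻¹ • u ∈ S
    · rw [Set.indicator_of_mem hmem]
      have h := birRate_pointwise_inside hqhom hm hC hG₀ hLg hK0 hR0 hKR hre hrem hg0 hgL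
        hre_q u hmem
      refine h.trans ?_
      rw [← one_div]
      calc (Lg * ((1 + 2 / m) / 2) + G₀ * C * ((2 / m) * (1 + 4 / m))) * (1 / Real.sqrt K)
            * Real.exp (-(m / 2) * ∑ i, u i ^ 2)
          = (Lg * ((1 + 2 / m) / 2) + G₀ * C * ((2 / m) * (1 + 4 / m))) / Real.sqrt K
            * Real.exp (-(m / 2) * ∑ i, u i ^ 2) := by ring
        _ ≤ A₁ / Real.sqrt K * Real.exp (-(m / 2) * ∑ i, u i ^ 2) := by
            refine mul_le_mul_of_nonneg_right (div_le_div_of_nonneg_right ?_ hsK.le) hE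
            rw [hA₁]; linarith
    · rw [Set.indicator_of_notMem hmem, zero_sub, norm_neg]
      have h := birRate_pointwise_outside hρ hball hm hG₀ hK hg0 hre_q u hmem
      refine h.trans ?_
      refine mul_le_mul_of_nonneg_right (div_le_div_of_nonneg_right ?_ hsK.le) hE
      rw [hA₁]; linarith
  -- integrate
  rw [birLaplace_scaling hS f g hK0, ← integral_const_mul, ← integral_sub hΦK_int hΦ_int]
  have hbound_int : Integrable fun u : ι → ℝ =>
      A₁ / Real.sqrt K * Real.exp (-(m / 2) * ∑ i, u i ^ 2) :=
    birLaplace_integrable_gaussian (by positivity) _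
  calc ‖∫ u : ι → ℝ, (S.indicator (fun δ => g δ * Complex.exp (-((K : ℂ) * f δ)))
          ((Real.sqrt K)⁻¹ • u) - g 0 * Complex.exp (-q u))‖
      ≤ ∫ u : ι → ℝ, A₁ / Real.sqrt K * Real.exp (-(m / 2) * ∑ i, u i ^ 2) :=
        norm_integral_le_of_norm_le hbound_int (Eventually.of_forall hpt)
    _ = A₁ * (∫ u : ι → ℝ, Real.exp (-(m / 2) * ∑ i, u i ^ 2)) / Real.sqrt K := by
        rw [integral_const_mul]; ring

end Rate

end Summit.HubbardSuperconductivity.HubbardSuperconductivity.Theorems
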